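import Literature.NumberTheory.EllipticCurves.WeberGamma2LevelNine
import Literature.NumberTheory.EllipticCurves.ModularCurveCoordinateRationality
import HarnessLib

/-!
# `γ₂(3τ) ∈ ℚ(X₀(9))`: the `q`-series of Weber's `γ₂(3τ)` is fixed by every endomorphism of `ℂ`
# (Cox, *Primes of the form x² + ny²*, §12.A (12.5): "`γ₂(τ) = q^{−1/3}(1 + Σ bₙqⁿ)`, `bₙ ∈ ℚ`")

Topic `NumberTheory/EllipticCurves`, namespace `Literature.NumberTheory.EllipticCurves.ModularForms`.
Theorem-only file (no definition, no named fact).  For the element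
`weberNineFn = γ₂(3τ) = E₄(3τ)η(3τ)¹⁶/Δ(3τ) ∈ K_9 ⊂ ℂ((q))` of `WeberGamma2LevelNine.lean` and every
ring endomorphism `σ` of `ℂ` acting coefficientwise (`mapLaurent σ`):

* `mapLaurent_weberNineFn` — **`σ` fixes the `q`-series of `γ₂(3τ)`** (the tree's form of "`γ₂(3τ)`
  has rational `q`-expansion", Cox (12.5), the hypothesis of Prop. 12.7 in the proof of Thm. 12.2).

Proof.  (1) `σ` fixes the `q`-series of `j(3τ) = E₄(3τ)³/Δ(3τ)` (`mapLaurent_kleinJThreeNineFn`; the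
tree's `isRatQExp_scaleN_E₄`, `isRatQExp_discriminant`).  (2) Hence `σ(γ₂(3τ))³ = γ₂(3τ)³` in the
field `ℂ((q))`, so `σ(γ₂(3τ)) = c·γ₂(3τ)` with `c ∈ {1, ζ₃, ζ₃²}` (`eq_of_pow_three_eq_one`: `X³ − 1`
splits over `ℂ`).  (3) `c = 1` by one rational coefficient: `γ₂(3τ)·Δ(3τ) = E₄(3τ)η(3τ)¹⁶` has
second `q`-coefficient `1` (`qExpansion_weberNineNum_coeff_two`), from `E₄(3τ) = 1 + O(q³)` and
**`η(3τ)⁸ = q + O(q²)`** (`qExpansion_etaOcticNine_coeff_one`, computed from the product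
`η(3z)⁸ = q∏(1 − q^{3(n+1)})⁸`, `etaOcticNine_eq_q_prod`, as a derivative of the cusp function —
the method of Mathlib's `discriminant_qExpansion_coeff_one`).

## References

* D. A. Cox, *Primes of the form x² + ny²*, 2nd ed., 2013, §12.A (12.5), Prop. 12.7, proof of
  Thm. 12.2. [Cox2013]
* F. Diamond, J. Shurman, *A First Course in Modular Forms*, GTM 228, 2005, §1.2 (`η`, `Δ`).
  [DiamondShurman2005]
-/

noncomputable section

open UpperHalfPlane hiding I
open Complex ModularForm CongruenceSubgroup EisensteinSeries PowerSeries Filter Topology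
open scoped MatrixGroups Real ModularForm Manifold

namespace Literature.NumberTheory.EllipticCurves.ModularForms

/-! ### The `q`-expansion of `η(3τ)⁸` starts `q + O(q²)` -/

/-- **`η(3z)⁸ = q ∏ (1 − q^{3(n+1)})⁸`**, `q = e^{2πiz}` (from Mathlib's product for `η`). [folklore] -/
theorem etaOcticNine_eq_q_prod (z : ℍ) :
    etaOcticNine z = Function.Periodic.qParam 1 z *
      ∏' n : ℕ, (1 - (Function.Periodic.qParam 1 z) ^ (3 * (n + 1))) ^ 8 := by
  have hz3 : (3 * (z : ℂ)) ∈ upperHalfPlaneSet := by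
    simpa using mul_pos (by norm_num : (0 : ℝ) < 3) z.2
  have hq24 : (Function.Periodic.qParam 24 (3 * (z : ℂ))) ^ 8 = Function.Periodic.qParam 1 z := by
    simp only [Function.Periodic.qParam]
    rw [← Complex.exp_nat_mul]
    congr 1
    push_cast
    ring
  have hq1 : ∀ n : ℕ, eta_q n (3 * (z : ℂ)) = (Function.Periodic.qParam 1 z) ^ (3 * (n + 1)) := by
    intro n
    simp only [eta_q, Function.Periodic.qParam]
    rw [← Complex.exp_nat_mul, ← Complex.exp_nat_mul]
    congr 1
    push_cast
    ring
  have hmult : Multipliable fun n : ℕ ↦ 1 - eta_q n (3 * (z : ℂ)) :=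
    multipliableLocallyUniformlyOn_eta.multipliable hz3
  rw [etaOcticNine_apply, ModularForm.eta, mul_pow, hq24, ← Multipliable.tprod_pow hmult]
  congr 1
  exact tprod_congr fun n ↦ by rw [hq1]

/-- `η(3τ)⁸ → 0` at `i∞`. [folklore] -/
theorem isZeroAtImInfty_etaOcticNine : IsZeroAtImInfty etaOcticNine := by
  have h := isZeroAtImInfty_etaOcticNine_slash 1
  simpa using h

/-- The cusp function of `η(3τ)⁸` on the unit disc is `q ∏ (1 − q^{3(i+1)})⁸`. [folklore] -/
theorem etaOcticNine_cuspFunction_eqOn : Set.EqOn (cuspFunction 1 etaOcticNine)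
    (fun q ↦ q * ∏' i : ℕ, (1 - q ^ (3 * (i + 1))) ^ 8) (Metric.ball 0 1) := by
  intro q hq
  by_cases hq0 : q = 0
  · simpa [hq0] using! Function.Periodic.cuspFunction_zero_of_zero_at_inf one_pos
      isZeroAtImInfty_etaOcticNine.zero_at_infty_comp_ofComplex
  · have him := Function.Periodic.im_invQParam_pos_of_norm_lt_one one_pos
      (by simpa [dist_zero_right] using hq) hq0
    simp [cuspFunction, Function.Periodic.cuspFunction_eq_of_nonzero 1 _ hq0,
      ofComplex_apply_of_im_pos him, etaOcticNine_eq_q_prod ⟨_, him⟩,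
      Function.Periodic.qParam_right_inv one_ne_zero hq0]

/-- The product factor is differentiable on the unit disc. [folklore] -/
theorem differentiableOn_tprod_one_sub_pow_three_mul :
    DifferentiableOn ℂ (fun q : ℂ ↦ ∏' i : ℕ, (1 - q ^ (3 * (i + 1))) ^ 8) (Metric.ball 0 1) := by
  have h := differentiableOn_tprod_one_sub_pow_pow 8
  have hcomp : (fun q : ℂ ↦ ∏' i : ℕ, (1 - q ^ (3 * (i + 1))) ^ 8) =
      (fun q : ℂ ↦ ∏' i : ℕ, (1 - q ^ (i + 1)) ^ 8) ∘ (fun q : ℂ ↦ q ^ 3) := by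
    funext q
    simp only [Function.comp_apply, ← pow_mul]
  rw [hcomp]
  refine h.comp (differentiableOn_pow 3) fun q hq ↦ ?_
  simp only [Metric.mem_ball, dist_zero_right, norm_pow] at hq ⊢
  calc ‖q‖ ^ 3 < 1 ^ 3 := by gcongr
    _ = 1 := one_pow 3

/-- **The first `q`-coefficient of `η(3τ)⁸` is `1`** (`η(3τ)⁸ = q − 8q⁴ + …`). [folklore] -/
theorem qExpansion_etaOcticNine_coeff_one : (qExpansion 1 etaOcticNine).coeff 1 = 1 := by
  have hmem : (0 : ℂ) ∈ Metric.ball (0 : ℂ) 1 := Metric.mem_ball_self one_pos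
  calc (qExpansion 1 etaOcticNine).coeff 1
      = derivWithin (cuspFunction 1 etaOcticNine) (Metric.ball 0 1) 0 := by
        simp [qExpansion_coeff, ← derivWithin_of_isOpen Metric.isOpen_ball hmem]
    _ = derivWithin (fun q ↦ q * ∏' i : ℕ, (1 - q ^ (3 * (i + 1))) ^ 8) (Metric.ball 0 1) 0 :=
        derivWithin_congr etaOcticNine_cuspFunction_eqOn (etaOcticNine_cuspFunction_eqOn hmem)
    _ = 1 := by
        rw [derivWithin_fun_mul differentiableWithinAt_fun_id
            (differentiableOn_tprod_one_sub_pow_three_mul _ hmem),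
          derivWithin_id' _ _ (Metric.isOpen_ball.uniqueDiffWithinAt hmem)]
        simp

/-- **The constant `q`-coefficient of `η(3τ)⁸` is `0`** (a cusp form). [folklore] -/
theorem qExpansion_etaOcticNine_coeff_zero : (qExpansion 1 etaOcticNine).coeff 0 = 0 := by
  have hmem : (0 : ℂ) ∈ Metric.ball (0 : ℂ) 1 := Metric.mem_ball_self one_pos
  rw [qExpansion_coeff]
  simp only [Nat.factorial_zero, Nat.cast_one, inv_one, iteratedDeriv_zero, one_mul]
  rw [etaOcticNine_cuspFunction_eqOn hmem]
  simp

/-! ### The second coefficient of `E₄(3τ)η(3τ)¹⁶` is `1` -/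

/-- Power-series algebra: `a₀(e) = 1`, `a₀(h) = 0`, `a₁(h) = 1` give `a₂(e·h·h) = 1`. [folklore] -/
theorem coeff_two_mul_mul_eq_one {e h : ℂ⟦X⟧} (he : coeff 0 e = 1) (h0 : coeff 0 h = 0)
    (h1 : coeff 1 h = 1) : coeff 2 (e * h * h) = 1 := by
  obtain ⟨r, hr⟩ : X ∣ h := PowerSeries.X_dvd_iff.mpr (by simpa using h0)
  have hr0 : coeff 0 r = 1 := by
    have := h1
    rw [hr, show (1 : ℕ) = 0 + 1 from rfl, PowerSeries.coeff_succ_X_mul] at this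
    exact this
  have hprod : e * h * h = X ^ 2 * (e * r * r) := by rw [hr]; ring
  rw [hprod, show (2 : ℕ) = 0 + 2 from rfl, PowerSeries.coeff_X_pow_mul]
  simp only [PowerSeries.coeff_zero_eq_constantCoeff, map_mul] at he hr0 ⊢
  rw [he, hr0]; ring

/-- `E₄(3τ)` has constant `q`-coefficient `1`. [folklore] -/
theorem qExpansion_E₄ThreeNine_coeff_zero : (qExpansion 1 ⇑E₄ThreeNine).coeff 0 = 1 := by
  change (qExpansion 1 ⇑(scaleN 3 ModularForm.E₄)).coeff 0 = 1
  rw [coeff_qExpansion_scaleN]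
  simp only [dvd_zero, ↓reduceIte, Nat.zero_div]
  exact EisensteinSeries.E_qExpansion_coeff_zero (by norm_num) (by decide)

/-- The underlying function of `etaOcticNineForm` is `etaOcticNine`. [folklore] -/
theorem coe_etaOcticNineForm : (⇑etaOcticNineForm : ℍ → ℂ) = etaOcticNine := rfl

/-- **`E₄(3τ)η(3τ)¹⁶ = q² + O(q³)`: the second `q`-coefficient of `weberNineNum` is `1`.** [folklore] -/
theorem qExpansion_weberNineNum_coeff_two : (qExpansion 1 ⇑weberNineNum).coeff 2 = 1 := by
  have hE := ModularFormClass.analyticAt_cuspFunction_zero E₄ThreeNine one_pos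
    (one_mem_strictPeriods_coe_gamma0 9)
  have hη := ModularFormClass.analyticAt_cuspFunction_zero etaOcticNineForm one_pos
    (one_mem_strictPeriods_coe_gamma0 9)
  have hEη : AnalyticAt ℂ (cuspFunction 1 (⇑E₄ThreeNine * ⇑etaOcticNineForm)) 0 := by
    rw [UpperHalfPlane.cuspFunction_mul hE.continuousAt hη.continuousAt]
    exact hE.mul hη
  rw [coe_weberNineNum, UpperHalfPlane.qExpansion_mul hEη hη, UpperHalfPlane.qExpansion_mul hE hη]
  exact coeff_two_mul_mul_eq_one qExpansion_E₄ThreeNine_coeff_zero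
    (by rw [coe_etaOcticNineForm]; exact qExpansion_etaOcticNine_coeff_zero)
    (by rw [coe_etaOcticNineForm]; exact qExpansion_etaOcticNine_coeff_one)

/-! ### Cube roots of unity in a field over `ℂ` -/

/-- `ζ₃³ = 1` for `ζ₃ = e^{2πi/3}`. [folklore] -/
theorem zeta3_pow_three' : cexp (2 * Real.pi * I / 3) ^ 3 = 1 := by
  rw [← Complex.exp_nat_mul]
  convert Complex.exp_two_pi_mul_I using 2
  push_cast
  ring

/-- `ζ₃ ≠ 1`. [folklore] -/
theorem zeta3_ne_one : cexp (2 * Real.pi * I / 3) ≠ 1 := by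
  intro h
  rw [Complex.exp_eq_one_iff] at h
  obtain ⟨n, hn⟩ := h
  have hπ : (2 * Real.pi * I : ℂ) ≠ 0 := by simp [Real.pi_ne_zero, I_ne_zero]
  have h3 : (1 : ℂ) / 3 = n := by
    field_simp at hn ⊢
    linear_combination hn
  have h3' : (3 : ℂ) * n = 1 := by rw [← h3]; norm_num
  have : (3 * n : ℤ) = 1 := by exact_mod_cast h3'
  omega

/-- `1 + ζ₃ + ζ₃² = 0`. [folklore] -/
theorem one_add_zeta3_add_sq :
    1 + cexp (2 * Real.pi * I / 3) + cexp (2 * Real.pi * I / 3) ^ 2 = 0 := by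
  have h := zeta3_pow_three'
  have hne := zeta3_ne_one
  have hfac : (cexp (2 * Real.pi * I / 3) - 1) * (1 + cexp (2 * Real.pi * I / 3) +
      cexp (2 * Real.pi * I / 3) ^ 2) = 0 := by linear_combination h
  rcases mul_eq_zero.mp hfac with h1 | h1
  · exact absurd (sub_eq_zero.mp h1) hne
  · exact h1

/-- **Cube roots of unity in a field over `ℂ`**: in a field `F ⊇ ℂ`, `w³ = 1` forces
`w ∈ {1, ζ₃, ζ₃²}` (`X³ − 1` splits over `ℂ`). [folklore] -/
theorem eq_of_pow_three_eq_one {F : Type*} [Field F] [Algebra ℂ F] {w : F} (hw : w ^ 3 = 1) :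
    w = 1 ∨ w = algebraMap ℂ F (cexp (2 * Real.pi * I / 3)) ∨
      w = algebraMap ℂ F (cexp (2 * Real.pi * I / 3) ^ 2) := by
  set ζ : ℂ := cexp (2 * Real.pi * I / 3) with hζ
  have h3 : (algebraMap ℂ F ζ) ^ 3 = 1 := by rw [← map_pow, zeta3_pow_three', map_one]
  have hs : 1 + algebraMap ℂ F ζ + (algebraMap ℂ F ζ) ^ 2 = 0 := by
    have := congrArg (algebraMap ℂ F) one_add_zeta3_add_sq
    simpa using this
  have hfac : (w - 1) * (w - algebraMap ℂ F ζ) * (w - algebraMap ℂ F (ζ ^ 2)) = 0 := by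
    rw [map_pow]
    linear_combination hw - w ^ 2 * hs + w * hs + (w - 1) * h3
  rcases mul_eq_zero.mp hfac with h12 | h3'
  · rcases mul_eq_zero.mp h12 with h1 | h2
    · exact Or.inl (sub_eq_zero.mp h1)
    · exact Or.inr (Or.inl (sub_eq_zero.mp h2))
  · exact Or.inr (Or.inr (sub_eq_zero.mp h3'))

/-! ### `σ` fixes the `q`-series of `j(3τ)` and of `γ₂(3τ)` -/

variable (σ : ℂ →+* ℂ)

/-- `E₄(3τ)` has a `σ`-fixed `q`-expansion. [folklore] -/
theorem isRatQExp_E₄ThreeNine : IsRatQExp σ ⇑E₄ThreeNine :=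
  isRatQExp_scaleN_E₄ (N := 3) σ

/-- `Δ(3τ)` has a `σ`-fixed `q`-expansion. [folklore] -/
theorem isRatQExp_deltaThreeNine : IsRatQExp σ ⇑deltaThreeNine :=
  isRatQExp_scaleN (N := 3) σ delta (isRatQExp_discriminant σ).map_eq

/-- `E₄(3τ)³` has a `σ`-fixed `q`-expansion. [folklore] -/
theorem isRatQExp_E₄ThreeNineCube : IsRatQExp σ ⇑E₄ThreeNineCube := by
  rw [coe_E₄ThreeNineCube]
  exact ((isRatQExp_E₄ThreeNine σ).mul (isRatQExp_E₄ThreeNine σ)).mul (isRatQExp_E₄ThreeNine σ)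

/-- `σ` fixes the Laurent `q`-series of a form with `σ`-fixed `q`-expansion. [folklore] -/
theorem mapLaurent_qExpansionL_eq {k : ℤ} {F : ModularForm (Gamma0 9) k} (hF : IsRatQExp σ ⇑F) :
    mapLaurent σ (qExpansionL 9 F) = qExpansionL 9 F := by
  rw [qExpansionL_def, mapLaurent_coe_powerSeries, hF.map_eq]

/-- **`σ` fixes the `q`-series of `j(3τ) ∈ K_9`.** [folklore] -/
theorem mapLaurent_kleinJThreeNineFn :
    mapLaurent σ ((kleinJThreeNineFn : modularFunctionField 9) : LaurentSeries ℂ) = kleinJThreeNineFn := by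
  change mapLaurent σ (qExpansionL 9 E₄ThreeNineCube / qExpansionL 9 deltaThreeNine) =
    qExpansionL 9 E₄ThreeNineCube / qExpansionL 9 deltaThreeNine
  rw [map_div₀, mapLaurent_qExpansionL_eq σ (isRatQExp_E₄ThreeNineCube σ),
    mapLaurent_qExpansionL_eq σ (isRatQExp_deltaThreeNine σ)]

/-- The transform of the `q`-series of `γ₂(3τ)` by `σ` is `c · γ₂(3τ)` for a cube root of unity `c`
(both are cube roots of the `σ`-fixed `q`-series of `j(3τ)` in the field `ℂ((q))`). [folklore] -/
theorem exists_mapLaurent_weberNineFn_eq_smul :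
    ∃ c : ℂ, c ^ 3 = 1 ∧ mapLaurent σ ((weberNineFn : modularFunctionField 9) : LaurentSeries ℂ) =
      algebraMap ℂ (LaurentSeries ℂ) c * weberNineFn := by
  set u : LaurentSeries ℂ := ((weberNineFn : modularFunctionField 9) : LaurentSeries ℂ) with hu
  have hcube : (mapLaurent σ u) ^ 3 = u ^ 3 := by
    have h3 : u ^ 3 = ((kleinJThreeNineFn : modularFunctionField 9) : LaurentSeries ℂ) := by
      rw [hu, ← SubmonoidClass.coe_pow, weberNineFn_pow_three]
    rw [← map_pow, h3, mapLaurent_kleinJThreeNineFn]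
  by_cases hu0 : u = 0
  · exact ⟨1, one_pow 3, by rw [hu0, map_zero, mul_zero]⟩
  · set w : LaurentSeries ℂ := mapLaurent σ u / u with hw
    have hw3 : w ^ 3 = 1 := by
      rw [hw, div_pow, hcube, div_self (pow_ne_zero 3 hu0)]
    have hwu : mapLaurent σ u = w * u := by rw [hw, div_mul_cancel₀ _ hu0]
    rcases eq_of_pow_three_eq_one hw3 with h | h | h
    · exact ⟨1, one_pow 3, by rw [hwu, h, map_one]⟩
    · exact ⟨_, zeta3_pow_three', by rw [hwu, h]⟩
    · refine ⟨_, ?_, by rw [hwu, h]⟩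
      rw [← pow_mul, show 2 * 3 = 3 * 2 by norm_num, pow_mul, zeta3_pow_three', one_pow]

/-- `algebraMap ℂ ℂ((q)) c` is the coercion of the constant power series `C c`. [folklore] -/
theorem algebraMap_laurentSeries_eq_coe_C (c : ℂ) :
    algebraMap ℂ (LaurentSeries ℂ) c = ((PowerSeries.C c : ℂ⟦X⟧) : LaurentSeries ℂ) := by
  rw [PowerSeries.coe_C]
  exact algebraMap_laurentSeries_apply c

/-- **`γ₂(3τ) ∈ ℚ(X₀(9))`: the `q`-series of `u₉ = γ₂(3τ) ∈ K_9` is fixed by every ring endomorphism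
`σ` of `ℂ`.**  By the previous lemma `σ(u₉) = c·u₉` with `c³ = 1`; applying `σ` to
`u₉ · Δ(3τ) = E₄(3τ)η(3τ)¹⁶` (whose second `q`-coefficient is `1`,
`qExpansion_weberNineNum_coeff_two`) gives `c = σ(1)/1 = 1`.  Classically: `γ₂(3τ)` has rational
`q`-expansion `q⁻¹(1 + …)` (Cox (12.5)). [cite: Cox2013, §12.A (12.5) and proof of Thm. 12.2 (`γ₂(3τ)` has rational coefficients)] -/
theorem mapLaurent_weberNineFn :
    mapLaurent σ ((weberNineFn : modularFunctionField 9) : LaurentSeries ℂ) = weberNineFn := by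
  obtain ⟨c, -, hc⟩ := exists_mapLaurent_weberNineFn_eq_smul σ
  set u : LaurentSeries ℂ := ((weberNineFn : modularFunctionField 9) : LaurentSeries ℂ) with hu
  -- `u · qL(Δ₃) = qL(F)` and its transform by `σ`
  have hrepr : u * qExpansionL 9 deltaThreeNine = qExpansionL 9 weberNineNum := mkFn_mul _ _ _
  have h1 : algebraMap ℂ (LaurentSeries ℂ) c * qExpansionL 9 weberNineNum =
      mapLaurent σ (qExpansionL 9 weberNineNum) := by
    have h := congrArg (mapLaurent σ) hrepr
    rw [map_mul, hc, mapLaurent_qExpansionL_eq σ (isRatQExp_deltaThreeNine σ), mul_assoc, hrepr] at h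
    exact h
  -- read off the second coefficient: `c · 1 = σ(1)`
  have h2 : PowerSeries.C c * qExpansion 1 ⇑weberNineNum = (qExpansion 1 ⇑weberNineNum).map σ := by
    apply HahnSeries.ofPowerSeries_injective (Γ := ℤ) (R := ℂ)
    rw [PowerSeries.coe_mul, ← algebraMap_laurentSeries_eq_coe_C, ← mapLaurent_coe_powerSeries]
    exact h1
  have h3 := congrArg (PowerSeries.coeff 2) h2
  rw [PowerSeries.coeff_C_mul, PowerSeries.coeff_map, qExpansion_weberNineNum_coeff_two, mul_one,
    map_one] at h3
  rw [hc, h3, map_one, one_mul]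

end Literature.NumberTheory.EllipticCurves.ModularForms

end
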